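import Summits.QuantumFields.YangMills.Theses.InfraredLiouville

/-!
# `InfraredLiouville.Assembly` — the assembly item of route `InfraredLiouville`

Route `InfraredLiouville` (sub-problem `YangMills` of summit `QuantumFields`) files, as its assembly
item `Assembly` (stmt-QuantumFields-9709), the implication chain

`IRLiouville → IRCompactness → ThinEdgeExclusion → GapToContinuum → YangMills`.

This is *verbatim* the type of the route's deciding theorem
`Summit.QuantumFields.YangMills.Theses.InfraredLiouville.closes` (planner-authored, sorry-free,
kernel-checked with the route file). Its content is pure logic: fix a compact simple `G`, put the
Borel σ-algebra on it, take `r` from `Nonempty (LatticeRep G)`; `IRLiouville` gives a threshold `β₀`;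
for `β ≥ β₀` and observables `A`, `B`, if super-polynomial decay of the connected torus
time-correlation failed, `IRCompactness` would produce a non-vacuum infrared limit point,
contradicting `IRLiouville` — so the hypothesis of `ThinEdgeExclusion` holds at `β₀`, its conclusion
is exactly the clustering hypothesis of `GapToContinuum`, whose conclusion is the body of `YangMills`.
This file closes the item by that definitional unfolding; it adds no mathematics of its own.

Sources: route-internal (the deciding theorem `closes`); Jaffe–Witten 2000 for the clauses packaged
in `YangMills`; Kenig–Merle 2006 for the compactness-plus-rigidity shape of the route.
Deliberately NOT here: any of the cruxes (`IRLiouville`, `IRCompactness`, `ThinEdgeExclusion`,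
`GapToContinuum`) or the support `StrongCouplingIRTrivial` — they stay open items of the route.
-/

namespace Summit.QuantumFields.YangMills.Theorems

/-- **`InfraredLiouville.Assembly` holds** (assembly item stmt-QuantumFields-9709): the chain
`IRLiouville → IRCompactness → ThinEdgeExclusion → GapToContinuum → YangMills`.
Proof: after unfolding, the goal is literally the type of the route's sorry-free deciding theorem
`InfraredLiouville.closes` (compactness + rigidity by contradiction, then the two implications).
[folklore] -/
theorem infraredLiouville_assembly_proof :
    Summit.QuantumFields.YangMills.Theses.InfraredLiouville.Assembly := by
  unfold Summit.QuantumFields.YangMills.Theses.InfraredLiouville.Assembly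
  exact Summit.QuantumFields.YangMills.Theses.InfraredLiouville.closes

end Summit.QuantumFields.YangMills.Theorems
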